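import Summits.CriticalPhenomena.PercolationContinuityZ3.Theorems.Transplant.Z3UnitGensAutDichotomy
import HarnessLib

/-!
# Rooted-link invariants of `Cay(ℤ³; S)`, GENERIC in the unit-range member: the common-neighbour count `cc`, its raw decidable form, the link-degree and
# cc-profile COUNTS, and their invariance under automorphisms fixing `0` — the member-independent transport half of the `LinkDichotomy` chase
# (Z3ChiralDozen §2 made generic; consumed by the generated certificates of gen_chase.py, P5-SHARPNESS row 39 / CHIRAL-UNITGENS.md)

builds on p205010 (kernel theorem, internal audit signed; external expert review pending) — nothing in this file uses p205010.
Lane `prim-bschramm`, seat `prim-bschramm-p5` (gen 7; refuter), helper file (`--supports stmt-CriticalPhenomena-4575`).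
* `UnitGens.ccRaw`, `UnitGens.ccSem`, `ccSem_eq_ccRaw`; `mem_S_of_fix`, `symm_fix_zero`, `ccSem_map`, `ccRaw_map`, `adj_map_iff'`, `degree_count_map`, `profile_count_map`.
[cite: BenjaminiSchramm1996, §2] [cite: KozmaNitzan2024, §4 p. 16 (Lemma 8)]
-/

noncomputable section

namespace Summit.CriticalPhenomena.PercolationContinuityZ3.Theorems.Transplant

open Literature.Probability.LatticeModels SimpleGraph
open scoped Classical

namespace UnitGens

variable (U : UnitGens)

/-- Raw (decidable once `U.S` is a literal) number of common neighbours of `u` and `w` other than `0`: the `x = u + s`, `s ∈ S`, `x ≠ 0`, `x − w ∈ S`. [this work] -/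
def ccRaw (u w : Site 3) : ℕ := ((U.S.image (u + ·)).filter fun x => x ≠ 0 ∧ x - w ∈ U.S).card

/-- Semantic form: common neighbours in `U.graph` other than `0`. [this work] -/
def ccSem (u w : Site 3) : ℕ := ((U.graph.neighborFinset u).filter fun x => x ≠ 0 ∧ U.graph.Adj w x).card

/-- `ccSem = ccRaw`. [folklore] -/
theorem ccSem_eq_ccRaw (u w : Site 3) : U.ccSem u w = U.ccRaw u w := by
  unfold ccSem ccRaw
  rw [U.neighborFinset_graph]
  apply congrArg Finset.card
  ext x
  simp only [Finset.mem_filter, U.graph_adj_iff]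

variable {U}

/-- Automorphisms fixing `0` preserve the link `S = N(0)`. [folklore] -/
theorem mem_S_of_fix (γ : U.graph ≃g U.graph) (h0 : γ 0 = 0) {v : Site 3} (hv : v ∈ U.S) : γ v ∈ U.S := by
  have hv' : U.graph.Adj 0 v := by rw [U.graph_adj_iff, sub_zero]; exact hv
  have := γ.map_adj_iff.2 hv'
  rw [h0, U.graph_adj_iff, sub_zero] at this
  exact this

/-- The inverse of an automorphism fixing `0` fixes `0`. [folklore] -/
theorem symm_fix_zero (γ : U.graph ≃g U.graph) (h0 : γ 0 = 0) : γ.symm 0 = 0 := by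
  have h := RelIso.symm_apply_apply γ 0
  rwa [h0] at h

/-- Link adjacency is transported both ways (difference form). [folklore] -/
theorem sub_mem_S_map_iff (γ : U.graph ≃g U.graph) {u w : Site 3} : γ w - γ u ∈ U.S ↔ w - u ∈ U.S := by
  rw [← U.graph_adj_iff, ← U.graph_adj_iff]; exact γ.map_adj_iff

/-- `ccSem u w ≤ ccSem (γ u) (γ w)`. [folklore] -/
theorem ccSem_le_map (γ : U.graph ≃g U.graph) (h0 : γ 0 = 0) (u w : Site 3) : U.ccSem u w ≤ U.ccSem (γ u) (γ w) := by
  unfold ccSem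
  calc ((U.graph.neighborFinset u).filter fun x => x ≠ 0 ∧ U.graph.Adj w x).card
      = (((U.graph.neighborFinset u).filter fun x => x ≠ 0 ∧ U.graph.Adj w x).image γ).card :=
        (Finset.card_image_of_injective _ γ.injective).symm
    _ ≤ ((U.graph.neighborFinset (γ u)).filter fun x => x ≠ 0 ∧ U.graph.Adj (γ w) x).card := by
        refine Finset.card_le_card fun x hx => ?_
        obtain ⟨y, hy, rfl⟩ := Finset.mem_image.1 hx
        simp only [Finset.mem_filter, SimpleGraph.mem_neighborFinset] at hy ⊢
        exact ⟨γ.map_adj_iff.2 hy.1, fun h => hy.2.1 (γ.injective (h.trans h0.symm)), γ.map_adj_iff.2 hy.2.2⟩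

/-- **`ccSem` is invariant under automorphisms fixing `0`.** [folklore] -/
theorem ccSem_map (γ : U.graph ≃g U.graph) (h0 : γ 0 = 0) (u w : Site 3) : U.ccSem (γ u) (γ w) = U.ccSem u w := by
  refine le_antisymm ?_ (ccSem_le_map γ h0 u w)
  have h := ccSem_le_map γ.symm (symm_fix_zero γ h0) (γ u) (γ w)
  rwa [RelIso.symm_apply_apply, RelIso.symm_apply_apply] at h

/-- **`ccRaw` is invariant under automorphisms fixing `0`.** [folklore] -/
theorem ccRaw_map (γ : U.graph ≃g U.graph) (h0 : γ 0 = 0) (u w : Site 3) : U.ccRaw (γ u) (γ w) = U.ccRaw u w := by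
  rw [← ccSem_eq_ccRaw, ← ccSem_eq_ccRaw]; exact ccSem_map γ h0 u w

/-- The link-degree count `#{w ∈ S : w − v ∈ S}` is invariant under automorphisms fixing `0`. [folklore] -/
theorem degree_count_map (γ : U.graph ≃g U.graph) (h0 : γ 0 = 0) (v : Site 3) :
    (U.S.filter fun w => w - γ v ∈ U.S).card = (U.S.filter fun w => w - v ∈ U.S).card := by
  symm
  refine Finset.card_bij (fun w _ => γ w) (fun w hw => ?_) (fun a _ b _ h => γ.injective h) (fun w hw => ?_)
  · rw [Finset.mem_filter] at hw ⊢
    exact ⟨mem_S_of_fix γ h0 hw.1, (sub_mem_S_map_iff γ).2 hw.2⟩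
  · rw [Finset.mem_filter] at hw
    refine ⟨γ.symm w, ?_, RelIso.apply_symm_apply γ w⟩
    rw [Finset.mem_filter]
    refine ⟨mem_S_of_fix γ.symm (symm_fix_zero γ h0) hw.1, ?_⟩
    have h2 := (sub_mem_S_map_iff γ (u := v) (w := γ.symm w)).1
    rw [RelIso.apply_symm_apply] at h2
    exact h2 hw.2

/-- The cc-profile count `#{w ∈ S : ccRaw v w = c}` is invariant under automorphisms fixing `0`. [folklore] -/
theorem profile_count_map (γ : U.graph ≃g U.graph) (h0 : γ 0 = 0) (v : Site 3) (c : ℕ) :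
    (U.S.filter fun w => U.ccRaw (γ v) w = c).card = (U.S.filter fun w => U.ccRaw v w = c).card := by
  symm
  refine Finset.card_bij (fun w _ => γ w) (fun w hw => ?_) (fun a _ b _ h => γ.injective h) (fun w hw => ?_)
  · rw [Finset.mem_filter] at hw ⊢
    exact ⟨mem_S_of_fix γ h0 hw.1, by rw [ccRaw_map γ h0]; exact hw.2⟩
  · rw [Finset.mem_filter] at hw
    refine ⟨γ.symm w, ?_, RelIso.apply_symm_apply γ w⟩
    rw [Finset.mem_filter]
    refine ⟨mem_S_of_fix γ.symm (symm_fix_zero γ h0) hw.1, ?_⟩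
    have := ccRaw_map γ h0 v (γ.symm w)
    rw [RelIso.apply_symm_apply] at this
    rw [← this]; exact hw.2

end UnitGens

end Summit.CriticalPhenomena.PercolationContinuityZ3.Theorems.Transplant

end
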